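import Summits.QuantumFields.BalabanUV.T4Continuum.Support.AveragingDeficitChartCalculus
import HarnessLib

/-!
# T⁴ programme, node NE3, row S6-Y7 (P3 leaf L7 «SLOP», part (a), ONE STEP) — file 1: THE ONE-STEP AVERAGE (42) ALONG
# THE COMPLEX PERTURBATION `σ ↦ V·e^{σX}` OF A CURVED SMALL-FIELD BACKGROUND: HOLOMORPHY OF THE RELATIVE CHART
# COORDINATE `σ ↦ log(V̄(c)⁻¹ · \overline{V e^{σX}}(c))` AND THE MOTION OF THE TRANSPORTERS (`BlockAverageVaryHolo`)

Cell `pub-balaban`, NE3 formalisation swarm (`t4/formal/NE3/LEAVES.md` row S5∕S6, sub-row S6-Y7; unit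
`b2b-balaban-t4-ne3-formalise-leaf-10`, gen 2).  Co-owner road P3 (`t4/skeletons/NE3-t4-ne3-p3.md` §2 leaf L7 «SLOP — the
chart replacement») needs the QUADRATIC REMAINDER of Bałaban's block average under a right perturbation of the
configuration: B7 Prop. 3 (122)–(123) ∕ Prop. 4 (134)–(136) TYPE ([Balaban1985Averaging] pp. 36–39: «`Q(V₀, A) =
L(Q(V₀)A) + C(V₀, A)`, `|C(V₀, A)| ≤ C₁L²|A|²`»).  The tree has the FLAT background only (`B7Prop3Flat.prop3_flat`,
`V₀ = 1`).  This file and its sequel `BlockAverageQuadRemainder` prove the one-step bound AT A CURVED small-field `U(N)`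
background WITHOUT the (89)–(121) expansion, by holomorphy: the perturbation parameter is taken COMPLEX,

  `cvary V X σ := (x, μ) ↦ V(x,μ)·exp(σ X(x,μ))`, `σ ∈ ℂ` (`cvary V X (s : ℂ) = vary V X s` definitionally),

and the relative chart coordinate of the average of the `L`-bond `c = (q, κ)`,

  `relAvg L V X q κ σ := log( V̄(c)⁻¹ · \overline{cvary V X σ}(c) )` (`log` = the series (21) `MatrixLog.mlog`),

is HOLOMORPHIC in `σ` (§2: finite products of `exp(±σX_b)` and constants along the contours (9), the series logarithm
inside its ball — tree `MatrixLog.analyticAt_mlog` —, finite sums, `NormedSpace.exp_analytic`; the pattern of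
`B7Prop3Flat` §3 and `AveragingDeficitChartCalculus` §4) and its MOTION UNDER THE PERTURBATION is controlled (§3): with `‖V(b)‖, ‖V(b)⁻¹‖ ≤ 1` and `‖X(b)‖ ≤ s` on the bonds
within `l¹`-distance `nbRad d L = 2dL + 2L` of `c₋ = q` (the radius containing every contour of (42) at `c`), each
transporter along a word `Γ` moves by at most `e^{|Γ|‖σ‖s} − 1` (`norm_hol_cvary_le`, telescoping), so the loop variables
and the straight contour move by at most `e^{nbRad·‖σ‖s} − 1` (`norm_Wcx_cvary_sub_le`).  The sequel
`BlockAverageVaryDisc` turns this into the disc `‖σ‖ < rho0 d L ∕ s` on which `relAvg` is holomorphic and bounded by `1∕2`,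
and `BlockAverageQuadRemainder` applies the tree's Schwarz-type Taylor toolkit (`NE9Lemma1RemainderPiece.norm_taylorRem_le`).

HONEST FRAMING: finite-`T⁴` kinematics of ONE block-averaging step on ONE lattice (rung (B)+1 — NOT infinite volume, NOT
a mass gap, NOT Clay); no two lattice spacings are compared; nothing of NE3 is claimed (NE3-E stays CONDITIONAL on the
co-owners' ⟨named structures⟩); no `BetaPertH`, no (B), no G-an2-4; no printed sentence is a hypothesis ([cite:] tags
are context).  PLACEMENT (human rule 2026-08-19): our work, under `Summits/QuantumFields/BalabanUV/`.
-/

set_option autoImplicit false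

open scoped BigOperators Matrix.Norms.L2Operator Topology
open NormedSpace Finset Filter Metric

namespace Summit.QuantumFields.BalabanUV.T4Continuum.BlockAverageVaryHolo

open Literature.MathematicalPhysics.QuantumFieldTheory.Balaban1983to89
open B7Prop1Explicit B7Prop2Explicit MatrixLog UnitaryModel
open T4AveragingDeficitWall hiding Site Plane Plaq Bond
open AveragingDeficitSideDeriv (loopWord length_loopWord norm_Xavg_le)

noncomputable section

variable {d : ℕ} {n : Type*} [Fintype n] [DecidableEq n]

/-! ## §1 The complex perturbation and the relative chart coordinate of the average -/

/-- THE COMPLEX ONE-PARAMETER PERTURBATION `V_σ(b) = V(b)·e^{σX(b)}`, `σ ∈ ℂ` — the holomorphic extension of the tree's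
`T4AveragingDeficitWall.vary` (`cvary V X (s : ℂ) = vary V X s`). [folklore] -/
def cvary (V : Site d → Fin d → (Matrix n n ℂ)ˣ) (X : Site d → Fin d → Matrix n n ℂ) (σ : ℂ) :
    Site d → Fin d → (Matrix n n ℂ)ˣ :=
  fun x μ => V x μ * expUnit (σ • X x μ)

/-- On real parameters the complex perturbation IS the tree's `vary`. [folklore] -/
@[simp] theorem cvary_ofReal (V : Site d → Fin d → (Matrix n n ℂ)ˣ) (X : Site d → Fin d → Matrix n n ℂ) (s : ℝ) :
    cvary V X (s : ℂ) = vary V X s := rfl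

/-- `V_0 = V`. [folklore] -/
@[simp] theorem cvary_zero (V : Site d → Fin d → (Matrix n n ℂ)ˣ) (X : Site d → Fin d → Matrix n n ℂ) :
    cvary V X 0 = V := by
  funext x μ; simp [cvary]

/-- `val_bavg`: the average (42) as a matrix, `V̄(c) = exp(X_c)·V(Γ_c)`. [cite: Balaban1985Averaging, (42) p.23] -/
theorem val_bavg (L : ℕ) (W : Site d → Fin d → (Matrix n n ℂ)ˣ) (q : Site d) (κ : Fin d) :
    ((bavg L W q κ : (Matrix n n ℂ)ˣ) : Matrix n n ℂ) = exp (Xavg L W q κ) * ((hol W q (seg κ L) : (Matrix n n ℂ)ˣ) : Matrix n n ℂ) := by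
  simp [bavg]

/-- The matrix `V̄(c)⁻¹ · \overline{V e^{σX}}(c)` whose logarithm is the relative chart coordinate. [folklore] -/
def relUnit (L : ℕ) (V : Site d → Fin d → (Matrix n n ℂ)ˣ) (X : Site d → Fin d → Matrix n n ℂ) (q : Site d) (κ : Fin d)
    (σ : ℂ) : Matrix n n ℂ :=
  (((bavg L V q κ)⁻¹ : (Matrix n n ℂ)ˣ) : Matrix n n ℂ) * ((bavg L (cvary V X σ) q κ : (Matrix n n ℂ)ˣ) : Matrix n n ℂ)

/-- THE RELATIVE CHART COORDINATE OF THE ONE-STEP AVERAGE along the complex perturbation: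
`relAvg L V X q κ σ = log( V̄(c)⁻¹ · \overline{V e^{σX}}(c) )`, `c = ⟨q, q + Le_κ⟩` — for real `σ` the coordinate
`log((cavg V)(b)⁻¹·(cavg (vary V X σ))(b))` of `AveragingDeficitChartCalculus.relLog` read at `q = L·y`; the object whose
second-order Taylor remainder at `σ = 0` is B7's `C(V₀, A)` (122) in the left-relative chart. [folklore] -/
def relAvg (L : ℕ) (V : Site d → Fin d → (Matrix n n ℂ)ˣ) (X : Site d → Fin d → Matrix n n ℂ) (q : Site d) (κ : Fin d)
    (σ : ℂ) : Matrix n n ℂ :=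
  mlog (relUnit L V X q κ σ)

/-- At `σ = 0` the relative unit is `1`. [folklore] -/
@[simp] theorem relUnit_zero (L : ℕ) (V : Site d → Fin d → (Matrix n n ℂ)ˣ) (X : Site d → Fin d → Matrix n n ℂ)
    (q : Site d) (κ : Fin d) : relUnit L V X q κ 0 = 1 := by
  simp [relUnit]

/-- At `σ = 0` the relative chart coordinate vanishes (`log 1 = 0`). [folklore] -/
@[simp] theorem relAvg_zero (L : ℕ) (V : Site d → Fin d → (Matrix n n ℂ)ˣ) (X : Site d → Fin d → Matrix n n ℂ)
    (q : Site d) (κ : Fin d) : relAvg L V X q κ 0 = 0 := by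
  simp [relAvg, MatrixLog.mlog_one]

/-! ## §2 Holomorphy in `σ` -/

/-- One bond: `σ ↦ V(b)e^{σX(b)}` is entire. [folklore] -/
theorem analyticAt_val_cvary (V : Site d → Fin d → (Matrix n n ℂ)ˣ) (X : Site d → Fin d → Matrix n n ℂ) (x : Site d)
    (μ : Fin d) (σ₀ : ℂ) :
    AnalyticAt ℂ (fun σ => ((cvary V X σ x μ : (Matrix n n ℂ)ˣ) : Matrix n n ℂ)) σ₀ := by
  simp only [cvary, Units.val_mul, val_expUnit]
  exact analyticAt_const.fun_mul ((exp_analytic _).fun_comp_of_eq (analyticAt_id.fun_smul analyticAt_const) rfl)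

/-- One bond, reversed: `σ ↦ (V(b)e^{σX(b)})⁻¹ = e^{−σX(b)}V(b)⁻¹` is entire. [folklore] -/
theorem analyticAt_val_cvary_inv (V : Site d → Fin d → (Matrix n n ℂ)ˣ) (X : Site d → Fin d → Matrix n n ℂ) (x : Site d)
    (μ : Fin d) (σ₀ : ℂ) :
    AnalyticAt ℂ (fun σ => (((cvary V X σ x μ)⁻¹ : (Matrix n n ℂ)ˣ) : Matrix n n ℂ)) σ₀ := by
  simp only [cvary, mul_inv_rev, Units.val_mul, val_inv_expUnit, val_expUnit]
  exact ((exp_analytic _).fun_comp_of_eq (analyticAt_id.fun_smul analyticAt_const).fun_neg rfl).fun_mul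
    analyticAt_const

/-- Parallel transport (9) of `V e^{σX}` along a fixed word is entire in `σ` (finite products). [folklore] -/
theorem analyticAt_val_hol_cvary (V : Site d → Fin d → (Matrix n n ℂ)ˣ) (X : Site d → Fin d → Matrix n n ℂ) (σ₀ : ℂ) :
    ∀ (w : List (Letter d)) (x : Site d),
      AnalyticAt ℂ (fun σ => ((hol (cvary V X σ) x w : (Matrix n n ℂ)ˣ) : Matrix n n ℂ)) σ₀
  | [], x => by simp only [hol_nil, Units.val_one]; exact analyticAt_const
  | (μ, true) :: w, x => by
      simp only [hol_cons, Units.val_mul, stepHol_true]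
      exact (analyticAt_val_cvary V X x μ σ₀).fun_mul (analyticAt_val_hol_cvary V X σ₀ w _)
  | (μ, false) :: w, x => by
      simp only [hol_cons, Units.val_mul, stepHol_false]
      exact (analyticAt_val_cvary_inv V X _ μ σ₀).fun_mul (analyticAt_val_hol_cvary V X σ₀ w _)

/-- The loop variables `W_{c,x} = V(Γ_{c,x})V(c)⁻¹` of (42) are entire in `σ`. [folklore] -/
theorem analyticAt_val_Wcx_cvary (V : Site d → Fin d → (Matrix n n ℂ)ˣ) (X : Site d → Fin d → Matrix n n ℂ) (σ₀ : ℂ)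
    (L : ℕ) (q : Site d) (κ : Fin d) (r : Site d) :
    AnalyticAt ℂ (fun σ => ((Wcx L (cvary V X σ) q κ r : (Matrix n n ℂ)ˣ) : Matrix n n ℂ)) σ₀ := by
  simp only [Wcx_eq_hol_loop]
  exact analyticAt_val_hol_cvary V X σ₀ _ q

/-- The exponent `X_c` of (42) is holomorphic in `σ` wherever every loop variable lies in the ball `|W − 1| < 1` of the
series logarithm (21). [folklore] -/
theorem analyticAt_Xavg_cvary (V : Site d → Fin d → (Matrix n n ℂ)ˣ) (X : Site d → Fin d → Matrix n n ℂ) (σ₀ : ℂ)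
    (L : ℕ) (q : Site d) (κ : Fin d)
    (hW : ∀ r : Fin d → Fin L, ‖((Wcx L (cvary V X σ₀) q κ (boxVec L r) : (Matrix n n ℂ)ˣ) : Matrix n n ℂ) - 1‖ < 1) :
    AnalyticAt ℂ (fun σ => Xavg L (cvary V X σ) q κ) σ₀ := by
  unfold Xavg
  exact Finset.analyticAt_fun_sum _ fun r _ =>
    ((analyticAt_mlog (hW r)).fun_comp_of_eq (analyticAt_val_Wcx_cvary V X σ₀ L q κ (boxVec L r)) rfl).fun_const_smul

/-- The average (42) `\overline{V e^{σX}}(c) = exp(X_c)·(V e^{σX})(Γ_c)` is holomorphic in `σ` (same domain condition).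
[folklore] -/
theorem analyticAt_val_bavg_cvary (V : Site d → Fin d → (Matrix n n ℂ)ˣ) (X : Site d → Fin d → Matrix n n ℂ) (σ₀ : ℂ)
    (L : ℕ) (q : Site d) (κ : Fin d)
    (hW : ∀ r : Fin d → Fin L, ‖((Wcx L (cvary V X σ₀) q κ (boxVec L r) : (Matrix n n ℂ)ˣ) : Matrix n n ℂ) - 1‖ < 1) :
    AnalyticAt ℂ (fun σ => ((bavg L (cvary V X σ) q κ : (Matrix n n ℂ)ˣ) : Matrix n n ℂ)) σ₀ := by
  simp only [val_bavg]
  exact ((exp_analytic _).fun_comp_of_eq (analyticAt_Xavg_cvary V X σ₀ L q κ hW) rfl).fun_mul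
    (analyticAt_val_hol_cvary V X σ₀ _ q)

/-- The relative unit `V̄(c)⁻¹·\overline{V e^{σX}}(c)` is holomorphic in `σ` (same domain condition). [folklore] -/
theorem analyticAt_relUnit (V : Site d → Fin d → (Matrix n n ℂ)ˣ) (X : Site d → Fin d → Matrix n n ℂ) (σ₀ : ℂ)
    (L : ℕ) (q : Site d) (κ : Fin d)
    (hW : ∀ r : Fin d → Fin L, ‖((Wcx L (cvary V X σ₀) q κ (boxVec L r) : (Matrix n n ℂ)ˣ) : Matrix n n ℂ) - 1‖ < 1) :
    AnalyticAt ℂ (relUnit L V X q κ) σ₀ := by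
  unfold relUnit
  exact analyticAt_const.fun_mul (analyticAt_val_bavg_cvary V X σ₀ L q κ hW)

/-- **THE RELATIVE CHART COORDINATE IS HOLOMORPHIC** wherever the loop variables of `V e^{σ₀X}` lie in the ball of (21) and
`‖V̄(c)⁻¹·\overline{V e^{σ₀X}}(c) − 1‖ < 1`. [folklore] -/
theorem analyticAt_relAvg (V : Site d → Fin d → (Matrix n n ℂ)ˣ) (X : Site d → Fin d → Matrix n n ℂ) (σ₀ : ℂ)
    (L : ℕ) (q : Site d) (κ : Fin d)
    (hW : ∀ r : Fin d → Fin L, ‖((Wcx L (cvary V X σ₀) q κ (boxVec L r) : (Matrix n n ℂ)ˣ) : Matrix n n ℂ) - 1‖ < 1)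
    (hY : ‖relUnit L V X q κ σ₀ - 1‖ < 1) :
    AnalyticAt ℂ (relAvg L V X q κ) σ₀ := by
  unfold relAvg
  exact (analyticAt_mlog hY).fun_comp_of_eq (analyticAt_relUnit V X σ₀ L q κ hW) rfl

/-! ## §3 How far the complex perturbation moves transporters, loop variables and the average -/

section Bounds

variable [Nonempty n]

/-- `U(N)` sits inside `{‖u‖ ≤ 1, ‖u⁻¹‖ ≤ 1}`. [folklore] -/
theorem U1_of_isUnitaryCfg {V : Site d → Fin d → (Matrix n n ℂ)ˣ} (hV : IsUnitaryCfg V) :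
    ∀ (x : Site d) (κ : Fin d), V x κ ∈ U1 (Matrix n n ℂ) := fun x κ =>
  ⟨(CStarRing.norm_of_mem_unitary (hV x κ)).le,
    (CStarRing.norm_of_mem_unitary ((unitaryUnits (Matrix n n ℂ)).inv_mem (hV x κ))).le⟩

/-- `‖e^{Y} − 1‖ ≤ e^{ρ} − 1` and `‖e^{Y}‖ ≤ e^{ρ}` for `‖Y‖ ≤ ρ`. [folklore] -/
theorem norm_exp_le_of_norm_le {Y : Matrix n n ℂ} {ρ : ℝ} (h : ‖Y‖ ≤ ρ) :
    ‖exp Y - 1‖ ≤ Real.exp ρ - 1 ∧ ‖exp Y‖ ≤ Real.exp ρ := by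
  have h1 : ‖exp Y - 1‖ ≤ Real.exp ρ - 1 := (norm_exp_sub_one_le_of_norm_le h).1
  refine ⟨h1, ?_⟩
  calc ‖exp Y‖ = ‖(exp Y - 1) + 1‖ := by rw [sub_add_cancel]
    _ ≤ ‖exp Y - 1‖ + ‖(1 : Matrix n n ℂ)‖ := norm_add_le _ _
    _ ≤ (Real.exp ρ - 1) + 1 := by rw [norm_one]; exact add_le_add h1 le_rfl
    _ = Real.exp ρ := by ring

omit [Nonempty n] in
/-- `‖B·E − B‖ ≤ e^ρ − 1` and `‖B·E‖ ≤ e^ρ` for `‖B‖ ≤ 1`, `‖E − 1‖ ≤ e^ρ − 1`, `‖E‖ ≤ e^ρ`. [folklore] -/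
theorem norm_mul_pert_le {B E : Matrix n n ℂ} {ρ : ℝ} (hB : ‖B‖ ≤ 1) (hE : ‖E - 1‖ ≤ Real.exp ρ - 1)
    (hE' : ‖E‖ ≤ Real.exp ρ) : ‖B * E - B‖ ≤ Real.exp ρ - 1 ∧ ‖B * E‖ ≤ Real.exp ρ := by
  constructor
  · rw [show B * E - B = B * (E - 1) by rw [mul_sub, mul_one]]
    calc ‖B * (E - 1)‖ ≤ ‖B‖ * ‖E - 1‖ := norm_mul_le _ _
      _ ≤ 1 * (Real.exp ρ - 1) := mul_le_mul hB hE (norm_nonneg _) zero_le_one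
      _ = Real.exp ρ - 1 := one_mul _
  · calc ‖B * E‖ ≤ ‖B‖ * ‖E‖ := norm_mul_le _ _
      _ ≤ 1 * Real.exp ρ := mul_le_mul hB hE' (norm_nonneg _) zero_le_one
      _ = Real.exp ρ := one_mul _

omit [Nonempty n] in
/-- `‖E·B − B‖ ≤ e^ρ − 1` and `‖E·B‖ ≤ e^ρ` for `‖B‖ ≤ 1`, `‖E − 1‖ ≤ e^ρ − 1`, `‖E‖ ≤ e^ρ`. [folklore] -/
theorem norm_pert_mul_le {B E : Matrix n n ℂ} {ρ : ℝ} (hB : ‖B‖ ≤ 1) (hE : ‖E - 1‖ ≤ Real.exp ρ - 1)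
    (hE' : ‖E‖ ≤ Real.exp ρ) : ‖E * B - B‖ ≤ Real.exp ρ - 1 ∧ ‖E * B‖ ≤ Real.exp ρ := by
  have hρ : 0 ≤ Real.exp ρ - 1 := (norm_nonneg _).trans hE
  constructor
  · rw [show E * B - B = (E - 1) * B by rw [sub_mul, one_mul]]
    calc ‖(E - 1) * B‖ ≤ ‖E - 1‖ * ‖B‖ := norm_mul_le _ _
      _ ≤ (Real.exp ρ - 1) * 1 := mul_le_mul hE hB (norm_nonneg _) hρ
      _ = Real.exp ρ - 1 := mul_one _
  · calc ‖E * B‖ ≤ ‖E‖ * ‖B‖ := norm_mul_le _ _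
      _ ≤ Real.exp ρ * 1 := mul_le_mul hE' hB (norm_nonneg _) (Real.exp_pos ρ).le
      _ = Real.exp ρ := mul_one _

omit [Nonempty n] in
/-- The forward letter of `V e^{σX}` as a matrix: `V(b)·e^{σX(b)}`. [folklore] -/
theorem val_stepHol_cvary_true (V : Site d → Fin d → (Matrix n n ℂ)ˣ) (X : Site d → Fin d → Matrix n n ℂ) (σ : ℂ)
    (x : Site d) (μ : Fin d) :
    ((stepHol (cvary V X σ) x (μ, true) : (Matrix n n ℂ)ˣ) : Matrix n n ℂ)
      = ((V x μ : (Matrix n n ℂ)ˣ) : Matrix n n ℂ) * exp (σ • X x μ) := by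
  simp [stepHol_true, cvary]

omit [Nonempty n] in
/-- The reversed letter of `V e^{σX}` as a matrix: `e^{−σX(b)}·V(b)⁻¹`, `b = ⟨x − e_μ, x⟩`. [folklore] -/
theorem val_stepHol_cvary_false (V : Site d → Fin d → (Matrix n n ℂ)ˣ) (X : Site d → Fin d → Matrix n n ℂ) (σ : ℂ)
    (x : Site d) (μ : Fin d) :
    ((stepHol (cvary V X σ) x (μ, false) : (Matrix n n ℂ)ˣ) : Matrix n n ℂ)
      = exp (-(σ • X (x - e μ) μ)) * (((V (x - e μ) μ)⁻¹ : (Matrix n n ℂ)ˣ) : Matrix n n ℂ) := by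
  simp [stepHol_false, cvary, mul_inv_rev]

/-- A bond one step back from a site with `|x − q|₁ + 1 ≤ R` starts in the `R`-ball about `q`. [folklore] -/
theorem l1_sub_e_le {x q : Site d} {R : ℕ} (hx : l1 (x - q) + 1 ≤ R) (μ : Fin d) : l1 (x - e μ - q) ≤ R := by
  have h := l1_add_le (x - q) (-e μ)
  rw [l1_neg, show l1 (e μ) = 1 from l1_vec (μ, true), show x - q + -e μ = x - e μ - q by abel] at h
  omega

/-- ONE LETTER: along `V e^{σX}` with `‖V(b)‖, ‖V(b)⁻¹‖ ≤ 1` and `‖X(b)‖ ≤ s` on the bonds of the `R`-ball about `q`, the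
transporter of a letter at a site with `|x − q|₁ + 1 ≤ R` moves by at most `e^{‖σ‖s} − 1` and has norm at most
`e^{‖σ‖s}`. [folklore] -/
theorem norm_stepHol_cvary_le {V : Site d → Fin d → (Matrix n n ℂ)ˣ}
    (hU : ∀ (x : Site d) (κ : Fin d), V x κ ∈ U1 (Matrix n n ℂ))
    {X : Site d → Fin d → Matrix n n ℂ} {q : Site d} {R : ℕ} {s : ℝ}
    (hX : ∀ (x : Site d) (μ : Fin d), l1 (x - q) ≤ R → ‖X x μ‖ ≤ s) (σ : ℂ) (x : Site d) (l : Letter d)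
    (hx : l1 (x - q) + 1 ≤ R) :
    ‖((stepHol (cvary V X σ) x l : (Matrix n n ℂ)ˣ) : Matrix n n ℂ) - ((stepHol V x l : (Matrix n n ℂ)ˣ) : Matrix n n ℂ)‖
        ≤ Real.exp (‖σ‖ * s) - 1 ∧
      ‖((stepHol (cvary V X σ) x l : (Matrix n n ℂ)ˣ) : Matrix n n ℂ)‖ ≤ Real.exp (‖σ‖ * s) := by
  obtain ⟨μ, b⟩ := l
  cases b
  · -- reversed letter
    have hXb : ‖-(σ • X (x - e μ) μ)‖ ≤ ‖σ‖ * s := by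
      rw [norm_neg, norm_smul]
      exact mul_le_mul_of_nonneg_left (hX _ μ (l1_sub_e_le hx μ)) (norm_nonneg σ)
    obtain ⟨h1, h2⟩ := norm_exp_le_of_norm_le hXb
    rw [val_stepHol_cvary_false, stepHol_false]
    exact norm_pert_mul_le (hU _ μ).2 h1 h2
  · -- forward letter
    have hXb : ‖σ • X x μ‖ ≤ ‖σ‖ * s := by
      rw [norm_smul]
      exact mul_le_mul_of_nonneg_left (hX x μ (by omega)) (norm_nonneg σ)
    obtain ⟨h1, h2⟩ := norm_exp_le_of_norm_le hXb
    rw [val_stepHol_cvary_true, stepHol_true]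
    exact norm_mul_pert_le (hU x μ).1 h1 h2

/-- ALONG A WORD: for a word `Γ` from `x` with `|x − q|₁ + |Γ| ≤ R` (every bond of `Γ` is then in the `R`-ball),
`‖(V e^{σX})(Γ) − V(Γ)‖ ≤ e^{|Γ|‖σ‖s} − 1` and `‖(V e^{σX})(Γ)‖ ≤ e^{|Γ|‖σ‖s}` (telescoping along the word; the unperturbed
transporters have norm `≤ 1`). [folklore] -/
theorem norm_hol_cvary_le {V : Site d → Fin d → (Matrix n n ℂ)ˣ}
    (hU : ∀ (x : Site d) (κ : Fin d), V x κ ∈ U1 (Matrix n n ℂ))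
    {X : Site d → Fin d → Matrix n n ℂ} {q : Site d} {R : ℕ} {s : ℝ}
    (hX : ∀ (x : Site d) (μ : Fin d), l1 (x - q) ≤ R → ‖X x μ‖ ≤ s) (σ : ℂ) :
    ∀ (w : List (Letter d)) (x : Site d), l1 (x - q) + w.length ≤ R →
      ‖((hol (cvary V X σ) x w : (Matrix n n ℂ)ˣ) : Matrix n n ℂ) - ((hol V x w : (Matrix n n ℂ)ˣ) : Matrix n n ℂ)‖
          ≤ Real.exp (w.length * (‖σ‖ * s)) - 1 ∧
        ‖((hol (cvary V X σ) x w : (Matrix n n ℂ)ˣ) : Matrix n n ℂ)‖ ≤ Real.exp (w.length * (‖σ‖ * s))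
  | [], x, _ => by simp
  | l :: w, x, hx => by
    rw [List.length_cons] at hx
    obtain ⟨hA1, hA2⟩ := norm_stepHol_cvary_le hU hX σ x l (by omega)
    have hx' : l1 (x + l.vec - q) + w.length ≤ R := by
      have := l1_add_le (x - q) l.vec
      rw [l1_vec, show x - q + l.vec = x + l.vec - q by abel] at this
      omega
    obtain ⟨ih1, ih2⟩ := norm_hol_cvary_le hU hX σ w (x + l.vec) hx'
    have hB : ‖((stepHol V x l : (Matrix n n ℂ)ˣ) : Matrix n n ℂ)‖ ≤ 1 := (stepHol_mem hU x l).1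
    have hρ : 0 ≤ Real.exp (‖σ‖ * s) - 1 := (norm_nonneg _).trans hA1
    set A := ((stepHol (cvary V X σ) x l : (Matrix n n ℂ)ˣ) : Matrix n n ℂ)
    set B := ((stepHol V x l : (Matrix n n ℂ)ˣ) : Matrix n n ℂ)
    set C := ((hol (cvary V X σ) (x + l.vec) w : (Matrix n n ℂ)ˣ) : Matrix n n ℂ)
    set D := ((hol V (x + l.vec) w : (Matrix n n ℂ)ˣ) : Matrix n n ℂ)
    rw [hol_cons, hol_cons, Units.val_mul, Units.val_mul, List.length_cons, Nat.cast_succ,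
      show ((w.length : ℝ) + 1) * (‖σ‖ * s) = ‖σ‖ * s + w.length * (‖σ‖ * s) by ring, Real.exp_add]
    constructor
    · calc ‖A * C - B * D‖ = ‖(A - B) * C + B * (C - D)‖ := by
            congr 1; simp only [sub_mul, mul_sub]; abel
        _ ≤ ‖A - B‖ * ‖C‖ + ‖B‖ * ‖C - D‖ :=
            (norm_add_le _ _).trans (add_le_add (norm_mul_le _ _) (norm_mul_le _ _))
        _ ≤ (Real.exp (‖σ‖ * s) - 1) * Real.exp (w.length * (‖σ‖ * s))
              + 1 * (Real.exp (w.length * (‖σ‖ * s)) - 1) :=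
            add_le_add (mul_le_mul hA1 ih2 (norm_nonneg _) hρ) (mul_le_mul hB ih1 (norm_nonneg _) zero_le_one)
        _ = Real.exp (‖σ‖ * s) * Real.exp (w.length * (‖σ‖ * s)) - 1 := by ring
    · calc ‖A * C‖ ≤ ‖A‖ * ‖C‖ := norm_mul_le _ _
        _ ≤ Real.exp (‖σ‖ * s) * Real.exp (w.length * (‖σ‖ * s)) :=
            mul_le_mul hA2 ih2 (norm_nonneg _) (Real.exp_pos _).le

/-- THE RADIUS OF THE CONTOUR NEIGHBOURHOOD of an `L`-bond: every contour `Γ_{c,x} ∪ (−Γ_c)` of (42) has length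
`2|x − c₋|₁ + 2L ≤ 2dL + 2L`, so all its bonds lie within `l¹`-distance `nbRad d L = 2dL + 2L` of `c₋`. [folklore] -/
def nbRad (d L : ℕ) : ℕ := 2 * (d * L) + 2 * L

/-- The loop words of (42) are no longer than `nbRad`. [folklore] -/
theorem length_loopWord_le (L : ℕ) (κ : Fin d) (r : Fin d → Fin L) :
    (loopWord L κ (boxVec L r)).length ≤ nbRad d L := by
  rw [length_loopWord, nbRad]
  have := l1_boxVec_le L r
  omega

/-- The straight contour `Γ_c` is no longer than `nbRad`. [folklore] -/
theorem length_seg_le (L : ℕ) (κ : Fin d) : (seg κ (L : ℤ)).length ≤ nbRad d L := by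
  rw [seg_natCast, List.length_replicate, nbRad]
  omega

/-- `|q − q|₁ = 0`. [folklore] -/
theorem l1_sub_self (q : Site d) : l1 (q - q) = 0 := by simp [l1]

/-- THE LOOP VARIABLES AND THE STRAIGHT CONTOUR UNDER THE PERTURBATION: with `‖X(b)‖ ≤ s` on the `nbRad`-ball about
`c₋ = q`, `‖W_{c,x}[V e^{σX}] − W_{c,x}[V]‖ ≤ e^{nbRad·‖σ‖s} − 1`, `‖(V e^{σX})(Γ_c) − V(Γ_c)‖ ≤ e^{nbRad·‖σ‖s} − 1` and
`‖(V e^{σX})(Γ_c)‖ ≤ e^{nbRad·‖σ‖s}`. [folklore] -/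
theorem norm_Wcx_cvary_sub_le {V : Site d → Fin d → (Matrix n n ℂ)ˣ}
    (hU : ∀ (x : Site d) (κ : Fin d), V x κ ∈ U1 (Matrix n n ℂ))
    {X : Site d → Fin d → Matrix n n ℂ} {q : Site d} {L : ℕ} {s : ℝ}
    (hX : ∀ (x : Site d) (μ : Fin d), l1 (x - q) ≤ nbRad d L → ‖X x μ‖ ≤ s) (σ : ℂ) (κ : Fin d) :
    (∀ r : Fin d → Fin L,
      ‖((Wcx L (cvary V X σ) q κ (boxVec L r) : (Matrix n n ℂ)ˣ) : Matrix n n ℂ)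
          - ((Wcx L V q κ (boxVec L r) : (Matrix n n ℂ)ˣ) : Matrix n n ℂ)‖
        ≤ Real.exp (nbRad d L * (‖σ‖ * s)) - 1) ∧
    ‖((hol (cvary V X σ) q (seg κ L) : (Matrix n n ℂ)ˣ) : Matrix n n ℂ)
        - ((hol V q (seg κ L) : (Matrix n n ℂ)ˣ) : Matrix n n ℂ)‖ ≤ Real.exp (nbRad d L * (‖σ‖ * s)) - 1 ∧
    ‖((hol (cvary V X σ) q (seg κ L) : (Matrix n n ℂ)ˣ) : Matrix n n ℂ)‖ ≤ Real.exp (nbRad d L * (‖σ‖ * s)) := by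
  have hs : 0 ≤ s := (norm_nonneg _).trans (hX q κ (by rw [l1_sub_self]; exact Nat.zero_le _))
  have hρ : 0 ≤ ‖σ‖ * s := mul_nonneg (norm_nonneg σ) hs
  have hmono : ∀ {m : ℕ}, m ≤ nbRad d L →
      Real.exp ((m : ℝ) * (‖σ‖ * s)) ≤ Real.exp ((nbRad d L : ℝ) * (‖σ‖ * s)) := fun hm =>
    Real.exp_le_exp.2 (mul_le_mul_of_nonneg_right (by exact_mod_cast hm) hρ)
  refine ⟨fun r => ?_, ?_, ?_⟩
  · have h := (norm_hol_cvary_le hU hX σ (loopWord L κ (boxVec L r)) q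
      (by rw [l1_sub_self, zero_add]; exact length_loopWord_le L κ r)).1
    rw [Wcx_eq_hol_loop, Wcx_eq_hol_loop]
    exact h.trans (sub_le_sub_right (hmono (length_loopWord_le L κ r)) 1)
  · have h := (norm_hol_cvary_le hU hX σ (seg κ L) q
      (by rw [l1_sub_self, zero_add]; exact length_seg_le L κ)).1
    exact h.trans (sub_le_sub_right (hmono (length_seg_le L κ)) 1)
  · have h := (norm_hol_cvary_le hU hX σ (seg κ L) q
      (by rw [l1_sub_self, zero_add]; exact length_seg_le L κ)).2
    exact h.trans (hmono (length_seg_le L κ))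

end Bounds

end

end Summit.QuantumFields.BalabanUV.T4Continuum.BlockAverageVaryHolo
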